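import Literature.MathematicalPhysics.QuantumManyBody.FubiniStudyAngle
import Literature.MathematicalPhysics.QuantumManyBody.TorusPoincareInequality
import HarnessLib

/-!
# Rigidity of near-minimisers along the impurity coupling path from a spectral gap; the free gas

Topic `Literature/MathematicalPhysics/QuantumManyBody` (companion of `PeriodicBoseGasCouplingPath.lean`,
`FubiniStudyAngle.lean`, `CouplingPathRigidity.lean` and `TorusPoincareInequality.lean`; helper for the
registered stub `stub_nearMinimiserRigidity` of crux `CorrectorClosure`, stmt-AtomisticToContinuum-12058,
line `llp-fidelity-arc`). Theorems only.

**The mechanism** (`exists_forall_fsAngle_le_of_gap`). Let `λ ↦ H_λ` be the coupling path of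
`coupledEnergy v λ` on tagged torus states with infimum `E_λ = coupledGroundStateEnergy v λ N L < ∞`.
If, in some isometric realisation `T` of the tagged states in a complex inner product space (the
`L²(cell)` classes, or a form-domain embedding), there is a unit vector `e` and a gap `g > 0` with the
**gap inequality**
`E_λ + g (1 - |⟪e, T Ψ⟫|²) ≤ ⟨Ψ, H_λ Ψ⟩` for every tagged trial state `Ψ` (as holds when `E_λ` is a
SIMPLE isolated eigenvalue with eigenvector `e` and `g = dist(E_λ, σ(H_λ) ∖ {E_λ})`: the fixed-volume
spectral frame), then the `δ`-near-minimisers are rigid: for every `ε > 0` there is `δ > 0` such that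
any two `δ`-near-minimisers are within Fubini–Study angle `ε`. Indeed a `δ`-near-minimiser has
`1 - |⟪e, T Ψ⟫|² ≤ δ/g ≤ sin²(ε/2)`, i.e. `arccos |⟪e, T Ψ⟫| ≤ ε/2` (`arccos_le_of_cos_sq_le`), and the
Fubini–Study angle of rays of `L²` satisfies the triangle inequality through `e`
(`arccos_norm_inner_le_add_of_norm_eq_one`). This is the hypothesis `hrig` of
`forall_fsAngle_le_of_rigidity` / `localSpeedBound_of_rigidity` (`CouplingPathRigidity.lean`); what it
leaves to spectral theory is exactly the pair `(e, g)`.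

**The free gas** (`v = 0`, all proved here). The coupled energy is the kinetic energy at every
coupling (`coupledEnergy_zeroPotential`: `u_λ = min(0, h(λ)) = 0`, `0^per = 0`), `E_λ = 0`
(`coupledGroundStateEnergy_zeroPotential`, the constant state `Ω = L^{-3(N+1)/2}`), and the free-gas
spectral gap `1 ≤ |⟨Ω, Ψ⟩|² + (L/2π)² ∫ |∇Ψ|²` (`one_le_normSq_taggedInner_const_add`, from the
Poincaré–Wirtinger inequality `lintegral_cellN_normSq_le`) is the gap inequality with `e = Ω`,
`g = (2π/L)²`. Hence:

* `exists_forall_fsAngle_le_zeroPotential` — **rigidity at `v = 0`** on every box `L`, for every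
  `N`, `λ`, `ε > 0`;
* `one_le_taggedZeroModeOccupation_add` — the tagged particle alone:
  `1 ≤ ⟨Ψ, P_{Ω,0}Ψ⟩ + (L/2π)² ∫ |∇₀Ψ|²` (`taggedZeroModeOccupation` of `PeriodicBoseGasTagged.lean`;
  the one-particle Poincaré inequality on every slice `x₀ ↦ Ψ(x₀, Y)`);
* `nearMinimiserRigidity_zeroPotential` — the same rigidity in the exact shape of the crux stub
  (thermodynamic boxes `L = sideLength ρ (N+1)`, eventually in `N`, uniformly in `λ ∈ [0,1]`): the stub
  holds for the free gas.

## References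

* [Gu2010] S.-J. Gu, *Fidelity approach to quantum phase transitions*, Int. J. Mod. Phys. B 24 (2010)
  4371: §2 (ground-state fidelity, Fubini–Study distance of rays, its perturbative control by the gap).
* [LiebLoss2001] E. H. Lieb, M. Loss, *Analysis*, 2nd ed. (2001): §7.9, Thm. 8.11 (kinetic energy in
  Fourier space; Poincaré inequality).
-/

noncomputable section

open MeasureTheory Filter
open scoped ENNReal NNReal ComplexConjugate InnerProductSpace

namespace Literature.MathematicalPhysics.QuantumManyBody.BoseGas

variable {N : ℕ} {L : ℝ}

/-! ## Rigidity from a gap inequality -/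

/-- The trigonometric step: for `θ ∈ [0, π/2]` and `a ≥ 0`, `cos² θ ≤ a²` gives `arccos a ≤ θ`.
[folklore] -/
theorem arccos_le_of_cos_sq_le {a θ : ℝ} (hθ0 : 0 ≤ θ) (hθ : θ ≤ Real.pi / 2) (ha : 0 ≤ a)
    (h : Real.cos θ ^ 2 ≤ a ^ 2) : Real.arccos a ≤ θ := by
  have hcos0 : 0 ≤ Real.cos θ := Real.cos_nonneg_of_mem_Icc ⟨by linarith [Real.pi_pos], hθ⟩
  have hle : Real.cos θ ≤ a := (sq_le_sq₀ hcos0 ha).mp h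
  calc Real.arccos a ≤ Real.arccos (Real.cos θ) := Real.arccos_le_arccos hle
    _ = θ := Real.arccos_cos hθ0 (by linarith [Real.pi_pos])

/-- **Rigidity of near-minimisers from a gap inequality.** Let the tagged trial states be realised
isometrically in a complex inner product space `E` (`T` with `⟪T Ψ, T Ψ'⟫ = ⟨Ψ, Ψ'⟩_cell`; e.g. the
`L²(cell)` classes `Ψ.memLp_two.toLp Ψ.ψ`, or a form-domain embedding). If
`E_λ = coupledGroundStateEnergy v λ N L` is finite and there are a unit vector `e ∈ E` and `g > 0` with
`E_λ + g (1 - |⟪e, T Ψ⟫|²) ≤ ⟨Ψ, H_λ Ψ⟩` for every tagged trial state `Ψ` (a simple ground state with a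
spectral gap), then for every `ε > 0` there is `δ > 0` such that any two `δ`-near-minimisers of
`coupledEnergy v λ` are within Fubini–Study angle `ε`.
[cite: Gu2010, §2 (ground-state fidelity controlled by the gap; Fubini–Study distance of rays)] -/
theorem exists_forall_fsAngle_le_of_gap {E : Type*} [NormedAddCommGroup E] [InnerProductSpace ℂ E]
    {v : ℝ → ℝ≥0∞} {lam : ℝ} (T : TaggedPeriodicTrialState N L → E)
    (hT : ∀ Ψ Ψ' : TaggedPeriodicTrialState N L, ⟪T Ψ, T Ψ'⟫_ℂ = taggedInner Ψ Ψ')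
    (e : E) (he : ‖e‖ = 1) {g : ℝ} (hg : 0 < g) (hE : coupledGroundStateEnergy v lam N L ≠ ⊤)
    (hgap : ∀ Ψ : TaggedPeriodicTrialState N L,
      coupledGroundStateEnergy v lam N L + ENNReal.ofReal (g * (1 - ‖⟪e, T Ψ⟫_ℂ‖ ^ 2)) ≤
        coupledEnergy v lam Ψ)
    {ε : ℝ} (hε : 0 < ε) :
    ∃ δ : ℝ≥0∞, 0 < δ ∧ ∀ Ψ Ψ' : TaggedPeriodicTrialState N L,
      coupledEnergy v lam Ψ ≤ coupledGroundStateEnergy v lam N L + δ →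
      coupledEnergy v lam Ψ' ≤ coupledGroundStateEnergy v lam N L + δ → fsAngle Ψ Ψ' ≤ ε := by
  -- the realisation is by unit vectors
  have hnorm : ∀ Φ : TaggedPeriodicTrialState N L, ‖T Φ‖ = 1 := fun Φ => by
    have h : ‖T Φ‖ ^ 2 = 1 := by
      rw [@norm_sq_eq_re_inner ℂ, hT, taggedInner_self, RCLike.one_re]
    nlinarith [norm_nonneg (T Φ)]
  -- the half-angle `θ = min (ε/2) (π/2)` and the energy budget `δ = g sin² θ`
  set θ : ℝ := min (ε / 2) (Real.pi / 2) with hθ_def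
  have hθ0 : 0 < θ := lt_min (by linarith) (by linarith [Real.pi_pos])
  have hθπ : θ ≤ Real.pi / 2 := min_le_right _ _
  have hθε : 2 * θ ≤ ε := by linarith [min_le_left (ε / 2) (Real.pi / 2)]
  have hsin : 0 < Real.sin θ := Real.sin_pos_of_pos_of_lt_pi hθ0 (by linarith [Real.pi_pos])
  refine ⟨ENNReal.ofReal (g * Real.sin θ ^ 2), ENNReal.ofReal_pos.2 (by positivity), fun Ψ Ψ' hΨ hΨ' => ?_⟩
  -- a near-minimiser is within angle `θ` of `e`
  have key : ∀ Φ : TaggedPeriodicTrialState N L,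
      coupledEnergy v lam Φ ≤ coupledGroundStateEnergy v lam N L + ENNReal.ofReal (g * Real.sin θ ^ 2) →
        Real.arccos ‖⟪e, T Φ⟫_ℂ‖ ≤ θ := by
    intro Φ hΦ
    set a : ℝ := ‖⟪e, T Φ⟫_ℂ‖ with ha
    have h1 : ENNReal.ofReal (g * (1 - a ^ 2)) ≤ ENNReal.ofReal (g * Real.sin θ ^ 2) :=
      (ENNReal.add_le_add_iff_left hE).1 ((hgap Φ).trans hΦ)
    rw [ENNReal.ofReal_le_ofReal_iff (by positivity)] at h1
    have h2 : 1 - a ^ 2 ≤ Real.sin θ ^ 2 := le_of_mul_le_mul_left h1 hg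
    refine arccos_le_of_cos_sq_le hθ0.le hθπ (norm_nonneg _) ?_
    rw [Real.cos_sq']
    linarith
  have h1 := key Ψ hΨ
  have h2 := key Ψ' hΨ'
  rw [← norm_inner_symm] at h1
  unfold fsAngle
  rw [← hT Ψ Ψ']
  calc Real.arccos ‖⟪T Ψ, T Ψ'⟫_ℂ‖
      ≤ Real.arccos ‖⟪T Ψ, e⟫_ℂ‖ + Real.arccos ‖⟪e, T Ψ'⟫_ℂ‖ :=
        arccos_norm_inner_le_add_of_norm_eq_one (hnorm Ψ) he (hnorm Ψ')
    _ ≤ θ + θ := add_le_add h1 h2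
    _ ≤ ε := by linarith

/-! ## The free coupled energy -/

/-- The free gas has no periodic pair interaction. [folklore] -/
private theorem periodicInteraction_zero_aux {M : ℕ} (L : ℝ) (Y : Config M) :
    periodicInteraction (0 : ℝ → ℝ≥0∞) L Y = 0 := by
  simp [periodicInteraction, periodizedPotential]

/-- Clipping the zero profile gives the zero profile: `u_λ = min(0, h(λ)) = 0`. [folklore] -/
theorem couplingProfile_zeroPotential (lam : ℝ) : couplingProfile (0 : ℝ → ℝ≥0∞) lam = 0 :=
  funext fun _ => min_eq_left bot_le

/-- **For `v = 0` the coupled energy is the free kinetic energy** at every coupling: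
`⟨Ψ, H_λ Ψ⟩ = ∫_{[0,L)^{3(N+1)}} |∇Ψ|²`. [folklore] -/
theorem coupledEnergy_zeroPotential (lam : ℝ) (Ψ : TaggedPeriodicTrialState N L) :
    coupledEnergy 0 lam Ψ = ∫⁻ X in cellN (N + 1) L, kineticDensity Ψ.ψ X := by
  unfold coupledEnergy
  refine lintegral_congr fun X => ?_
  rw [couplingProfile_zeroPotential, impurityInteraction_zero, periodicInteraction_zero_aux, zero_add,
    zero_mul, add_zero, taggedKineticDensity_one]

/-- A constant function has no kinetic energy (local copy of `kineticDensity_const` of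
`GroundStateDirichletForm.lean`, not imported here). [folklore] -/
private theorem kineticDensity_const_aux {M : ℕ} (c : ℂ) (X : Config M) :
    kineticDensity (fun _ : Config M => c) X = 0 := by
  simp [kineticDensity]

/-- The constant state `Ω = L^{-3(N+1)/2}` has zero free energy. [folklore] -/
theorem coupledEnergy_zeroPotential_const (lam : ℝ) (hL : 0 < L) :
    coupledEnergy 0 lam (TaggedPeriodicTrialState.const N hL) = 0 := by
  rw [coupledEnergy_zeroPotential]
  simp only [TaggedPeriodicTrialState.const, kineticDensity_const_aux, lintegral_zero]

/-- **`E_λ(v = 0) = 0`**: the free coupled ground-state energy vanishes on every box `L > 0`.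
[folklore] -/
theorem coupledGroundStateEnergy_zeroPotential (lam : ℝ) (N : ℕ) (hL : 0 < L) :
    coupledGroundStateEnergy 0 lam N L = 0 :=
  le_antisymm ((coupledGroundStateEnergy_le 0 lam _).trans_eq
    (coupledEnergy_zeroPotential_const lam hL)) bot_le

/-! ## The overlap with the constant state and the free-gas gap inequality -/

/-- The overlap with the constant state is `L^{-3(N+1)/2} ∫ Ψ`. [folklore] -/
theorem taggedInner_const_left (hL : 0 < L) (Ψ : TaggedPeriodicTrialState N L) :
    taggedInner (TaggedPeriodicTrialState.const N hL) Ψ =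
      ((Real.sqrt (L ^ 3))⁻¹ : ℂ) ^ (N + 1) * ∫ X in cellN (N + 1) L, Ψ.ψ X := by
  unfold taggedInner
  rw [← integral_const_mul]
  refine integral_congr_ae (Eventually.of_forall fun X => ?_)
  simp only [TaggedPeriodicTrialState.const, map_pow, map_inv₀, Complex.conj_ofReal]

/-- `‖⟨Ω, Ψ⟩‖² = L^{3(N+1)} ‖ĉ₀(Ψ)‖²`: the squared overlap with the constant state is the
(volume-normalised) squared zeroth Fourier coefficient. [folklore] -/
theorem normSq_taggedInner_const (hL : 0 < L) (Ψ : TaggedPeriodicTrialState N L) :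
    ((‖taggedInner (TaggedPeriodicTrialState.const N hL) Ψ‖₊ : ℝ≥0∞) ^ 2) =
      (ENNReal.ofReal L ^ 3) ^ (N + 1) * (‖configFourierCoeff L Ψ.ψ 0‖₊ : ℝ≥0∞) ^ 2 := by
  have hL3 : 0 < L ^ 3 := by positivity
  set A : ℝ := ‖∫ X in cellN (N + 1) L, Ψ.ψ X‖ with hA
  have h1 : ‖taggedInner (TaggedPeriodicTrialState.const N hL) Ψ‖ =
      ((Real.sqrt (L ^ 3))⁻¹) ^ (N + 1) * A := by
    rw [taggedInner_const_left hL, norm_mul, norm_pow, norm_inv, Complex.norm_real,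
      Real.norm_of_nonneg (Real.sqrt_nonneg _)]
  have h2 : ‖configFourierCoeff L Ψ.ψ 0‖ = ((L ^ 3)⁻¹) ^ (N + 1) * A := by
    rw [configFourierCoeff_zero hL Ψ.contDiff.continuous.aestronglyMeasurable, norm_smul,
      Real.norm_of_nonneg (by positivity)]
  rw [coe_nnnorm_sq_eq_ofReal, coe_nnnorm_sq_eq_ofReal, ← ENNReal.ofReal_pow hL.le,
    ← ENNReal.ofReal_pow hL3.le, ← ENNReal.ofReal_mul (by positivity), h1, h2]
  congr 1
  rw [mul_pow, mul_pow, ← mul_assoc]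
  congr 1
  rw [← pow_mul, mul_comm (N + 1) 2, pow_mul, inv_pow, Real.sq_sqrt hL3.le, sq, ← mul_assoc,
    ← mul_pow, mul_inv_cancel₀ hL3.ne', one_pow, one_mul]

/-- **Free-gas fidelity bound with the constant state** (`ℝ≥0∞` form):
`1 ≤ |⟨Ω, Ψ⟩|² + (L/2π)² ∫_{[0,L)^{3(N+1)}} |∇Ψ|²` for every tagged torus state `Ψ` — the spectral
gap `(2π/L)²` of the free kinetic energy above the constant mode.
[cite: LiebLoss2001, §7.9 and Thm. 8.11 (kinetic energy in Fourier space; Poincaré inequality)] -/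
theorem one_le_normSq_taggedInner_const_add (hL : 0 < L) (Ψ : TaggedPeriodicTrialState N L) :
    (1 : ℝ≥0∞) ≤ (‖taggedInner (TaggedPeriodicTrialState.const N hL) Ψ‖₊ : ℝ≥0∞) ^ 2 +
      ENNReal.ofReal ((L / (2 * Real.pi)) ^ 2) * ∫⁻ X in cellN (N + 1) L, kineticDensity Ψ.ψ X := by
  rw [normSq_taggedInner_const hL, ← Ψ.norm_eq]
  exact lintegral_cellN_normSq_le hL Ψ.contDiff Ψ.periodic

/-- **The free-gas gap inequality** along the (trivial) coupling path of `v = 0`: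
`E_λ + (2π/L)² (1 - |⟨Ω, Ψ⟩|²) ≤ ⟨Ψ, H_λ Ψ⟩` with `E_λ = 0` and `Ω` the constant state, for every
tagged trial state `Ψ`. [folklore] -/
theorem gapInequality_zeroPotential (hL : 0 < L) (lam : ℝ) (Ψ : TaggedPeriodicTrialState N L) :
    coupledGroundStateEnergy 0 lam N L + ENNReal.ofReal ((2 * Real.pi / L) ^ 2 *
        (1 - ‖⟪(TaggedPeriodicTrialState.const N hL).memLp_two.toLp
          (TaggedPeriodicTrialState.const N hL).ψ, Ψ.memLp_two.toLp Ψ.ψ⟫_ℂ‖ ^ 2)) ≤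
      coupledEnergy 0 lam Ψ := by
  rw [coupledGroundStateEnergy_zeroPotential lam N hL, zero_add, coupledEnergy_zeroPotential,
    TaggedPeriodicTrialState.inner_toLp]
  set a : ℝ := ‖taggedInner (TaggedPeriodicTrialState.const N hL) Ψ‖ with ha
  set K : ℝ≥0∞ := ∫⁻ X in cellN (N + 1) L, kineticDensity Ψ.ψ X with hK
  have hc : 0 < (L / (2 * Real.pi)) ^ 2 := by positivity
  have hcc : (2 * Real.pi / L) ^ 2 * (L / (2 * Real.pi)) ^ 2 = 1 := by
    field_simp
  have h := one_le_normSq_taggedInner_const_add hL Ψ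
  rw [coe_nnnorm_sq_eq_ofReal, ← ha, ← hK, ← ENNReal.ofReal_one] at h
  -- `ofReal (1 - a²) ≤ (L/2π)² K`, then multiply by `(2π/L)²`
  have h1 : ENNReal.ofReal (1 - a ^ 2) ≤ ENNReal.ofReal ((L / (2 * Real.pi)) ^ 2) * K := by
    rw [ENNReal.ofReal_sub _ (sq_nonneg a)]
    exact tsub_le_iff_left.2 h
  calc ENNReal.ofReal ((2 * Real.pi / L) ^ 2 * (1 - a ^ 2))
      = ENNReal.ofReal ((2 * Real.pi / L) ^ 2) * ENNReal.ofReal (1 - a ^ 2) :=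
        ENNReal.ofReal_mul (sq_nonneg _)
    _ ≤ ENNReal.ofReal ((2 * Real.pi / L) ^ 2) * (ENNReal.ofReal ((L / (2 * Real.pi)) ^ 2) * K) :=
        mul_le_mul' le_rfl h1
    _ = K := by
        rw [← mul_assoc, ← ENNReal.ofReal_mul (sq_nonneg _), hcc, ENNReal.ofReal_one, one_mul]

/-! ## The tagged particle alone: zero-mode depletion versus its own kinetic energy -/

/-- `e_0 ⊗ u = (u, 0)`: the single at the tag is a `vecCons`. [folklore] -/
theorem single_zero_eq_vecCons (u : Space) :
    (Pi.single (0 : Fin (N + 1)) u : Config (N + 1)) = Matrix.vecCons u (0 : Config N) := by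
  funext i
  refine Fin.cases ?_ (fun j => ?_) i
  · simp
  · simp [Fin.succ_ne_zero]

/-- Moving the tagged particle: `(x + u, Y) = (x, Y) + e_0 ⊗ u`. [folklore] -/
theorem vecCons_add_single_zero (x u : Space) (Y : Config N) :
    (Matrix.vecCons (x + u) Y : Config (N + 1)) = Matrix.vecCons x Y + Pi.single 0 u := by
  rw [single_zero_eq_vecCons, Matrix.cons_add_cons, add_zero]

/-- Inserting the bath, `x₀ ↦ (x₀, Y)`, is smooth (affine). [folklore] -/
theorem contDiff_vecCons_left {n : WithTop ℕ∞} (Y : Config N) :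
    ContDiff ℝ n fun y : Space => (Matrix.vecCons y Y : Config (N + 1)) := by
  refine contDiff_pi.2 fun i => ?_
  refine Fin.cases ?_ (fun j => ?_) i
  · simp only [Matrix.cons_val_zero]
    exact contDiff_id
  · simp only [Matrix.cons_val_succ]
    exact contDiff_const

/-- **Chain rule along the tagged direction**: `|∇(Ψ(·, Y))|²(x₀) = |∇₀Ψ|²(x₀, Y)`. [folklore] -/
theorem gradSqC_vecCons_slice {Ψ : Config (N + 1) → ℂ} (hΨ : Differentiable ℝ Ψ) (x : Space)
    (Y : Config N) :
    gradSqC (fun y => Ψ (Matrix.vecCons y Y)) x = ∑ k : Fin 3,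
      (‖fderiv ℝ Ψ (Matrix.vecCons x Y) (Pi.single 0 (EuclideanSpace.single k (1 : ℝ)))‖₊ : ℝ≥0∞) ^ 2 := by
  have hupd : ∀ y : Space,
      Function.update (Matrix.vecCons x Y : Config (N + 1)) 0 y = Matrix.vecCons y Y := fun y => by
    rw [Matrix.vecCons, Fin.update_cons_zero]
    rfl
  have h := gradSqC_slice hΨ (Matrix.vecCons x Y) 0 x
  simp only [hupd] at h
  exact h

/-- `L³ |ĉ₀(φ)|² = L⁻³ |∫_{[0,L)³} φ|²` (the zeroth coefficient is the mean) — duplicate of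
`BoseGas.ofReal_mul_nnnorm_sq_cellFourierCoeff_zero` (`PeriodicBoseGasLemma33.lean`), kept as a
deprecated alias (librarian dedup-01459). [folklore] -/
@[deprecated ofReal_mul_nnnorm_sq_cellFourierCoeff_zero (since := "2026-08-16")]
alias ofReal_mul_nnnorm_cellFourierCoeff_zero_sq := ofReal_mul_nnnorm_sq_cellFourierCoeff_zero

/-- **Zero-mode depletion of the tagged particle costs its own kinetic energy at the gap rate**:
`1 ≤ ⟨Ψ, P_{Ω,0} Ψ⟩ + (L/2π)² ∫_{[0,L)^{3(N+1)}} |∇₀Ψ|²` for every tagged torus state, i.e.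
`⟨Ψ, P_{Ω,0}^⊥ Ψ⟩ ≤ (L/2π)² ⟨Ψ, -Δ₀ Ψ⟩` (the one-particle Poincaré inequality
`lintegral_cell_normSq_le` on every slice `x₀ ↦ Ψ(x₀, Y)`, integrated over the bath: the free-gas
torus BEC mechanism for the inserted particle).
[cite: LiebLoss2001, §7.9 and Thm. 8.11 (kinetic energy in Fourier space; Poincaré inequality)] -/
theorem one_le_taggedZeroModeOccupation_add (Ψ : TaggedPeriodicTrialState N L) :
    (1 : ℝ≥0∞) ≤ taggedZeroModeOccupation N L Ψ.ψ + ENNReal.ofReal ((L / (2 * Real.pi)) ^ 2) *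
      ∫⁻ X in cellN (N + 1) L, ∑ k : Fin 3,
        (‖fderiv ℝ Ψ.ψ X (Pi.single 0 (EuclideanSpace.single k (1 : ℝ)))‖₊ : ℝ≥0∞) ^ 2 := by
  have hL := Ψ.side_pos
  have hΨd : Differentiable ℝ Ψ.ψ := Ψ.contDiff.differentiable one_ne_zero
  set C : ℝ≥0∞ := ENNReal.ofReal ((L / (2 * Real.pi)) ^ 2) with hC
  set V : ℝ≥0∞ := ENNReal.ofReal L ^ 3 with hV
  set g : Config (N + 1) → ℝ≥0∞ := fun X => ∑ k : Fin 3,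
    (‖fderiv ℝ Ψ.ψ X (Pi.single 0 (EuclideanSpace.single k (1 : ℝ)))‖₊ : ℝ≥0∞) ^ 2 with hg
  have hgm : Measurable g := measurable_gradSqAt 0 Ψ.ψ
  have hF : Measurable fun X => (‖Ψ.ψ X‖₊ : ℝ≥0∞) ^ 2 :=
    (Ψ.contDiff.continuous.measurable.nnnorm.coe_nnreal_ennreal).pow_const _
  have hVi : V⁻¹ ≠ ⊤ := ENNReal.inv_ne_top.2 (pow_ne_zero _ (ENNReal.ofReal_pos.2 hL).ne')
  have hmeas : Measurable fun Y : Config N => ∫⁻ x in cell L, g (Matrix.vecCons x Y) := by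
    have hunc : Measurable (Function.uncurry fun (Y : Config N) (x : Space) => g (Matrix.vecCons x Y)) :=
      measurable_swap_iff.1 (hgm.comp measurable_vecCons)
    exact hunc.lintegral_prod_right
  -- the one-particle Poincaré inequality on every slice `x₀ ↦ Ψ(x₀, Y)`
  have hslice : ∀ Y : Config N, ∫⁻ x in cell L, (‖Ψ.ψ (Matrix.vecCons x Y)‖₊ : ℝ≥0∞) ^ 2 ≤
      V⁻¹ * (‖∫ x in cell L, Ψ.ψ (Matrix.vecCons x Y)‖₊ : ℝ≥0∞) ^ 2 +
        C * ∫⁻ x in cell L, g (Matrix.vecCons x Y) := by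
    intro Y
    have hφ : ContDiff ℝ 1 fun y : Space => Ψ.ψ (Matrix.vecCons y Y) :=
      Ψ.contDiff.comp (contDiff_vecCons_left Y)
    have hper : ∀ (y : Space) (k : Fin 3),
        Ψ.ψ (Matrix.vecCons (y + EuclideanSpace.single k L) Y) = Ψ.ψ (Matrix.vecCons y Y) :=
      fun y k => by rw [vecCons_add_single_zero, Ψ.periodic]
    have h := lintegral_cell_normSq_le hL hφ hper
    rw [ofReal_mul_nnnorm_sq_cellFourierCoeff_zero hL] at h
    simpa only [gradSqC_vecCons_slice hΨd] using h
  calc (1 : ℝ≥0∞) = ∫⁻ X in cellN (N + 1) L, (‖Ψ.ψ X‖₊ : ℝ≥0∞) ^ 2 := Ψ.norm_eq.symm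
    _ = ∫⁻ Y in cellN N L, ∫⁻ x in cell L, (‖Ψ.ψ (Matrix.vecCons x Y)‖₊ : ℝ≥0∞) ^ 2 :=
        setLIntegral_cellN_succ_right hF
    _ ≤ ∫⁻ Y in cellN N L, (V⁻¹ * (‖∫ x in cell L, Ψ.ψ (Matrix.vecCons x Y)‖₊ : ℝ≥0∞) ^ 2 +
          C * ∫⁻ x in cell L, g (Matrix.vecCons x Y)) := lintegral_mono hslice
    _ = (V⁻¹ * ∫⁻ Y in cellN N L, (‖∫ x in cell L, Ψ.ψ (Matrix.vecCons x Y)‖₊ : ℝ≥0∞) ^ 2) +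
          C * ∫⁻ Y in cellN N L, ∫⁻ x in cell L, g (Matrix.vecCons x Y) := by
        rw [lintegral_add_right _ (hmeas.const_mul C), lintegral_const_mul' _ _ hVi,
          lintegral_const_mul' C _ ENNReal.ofReal_ne_top]
    _ = taggedZeroModeOccupation N L Ψ.ψ + C * ∫⁻ X in cellN (N + 1) L, g X := by
        rw [taggedZeroModeOccupation, ← setLIntegral_cellN_succ_right hgm]

/-! ## Rigidity of near-minimisers at `v = 0` -/

/-- **Rigidity of near-minimisers of the free coupled gas.** For `v = 0`, every box `L`, every `N`,
`λ` and `ε > 0` there is `δ > 0` such that any two `δ`-near-minimisers of `coupledEnergy 0 λ` are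
within Fubini–Study angle `ε` (the gap inequality of the free gas with `e = Ω`, `g = (2π/L)²`, fed into
`exists_forall_fsAngle_le_of_gap`). This is the hypothesis `hrig` of `CouplingPathRigidity.lean` for
the free gas. [folklore] -/
theorem exists_forall_fsAngle_le_zeroPotential (N : ℕ) (L lam : ℝ) {ε : ℝ} (hε : 0 < ε) :
    ∃ δ : ℝ≥0∞, 0 < δ ∧ ∀ Ψ Ψ' : TaggedPeriodicTrialState N L,
      coupledEnergy 0 lam Ψ ≤ coupledGroundStateEnergy 0 lam N L + δ →
      coupledEnergy 0 lam Ψ' ≤ coupledGroundStateEnergy 0 lam N L + δ → fsAngle Ψ Ψ' ≤ ε := by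
  by_cases hL : 0 < L
  swap
  · exact ⟨1, one_pos, fun Ψ => absurd Ψ.side_pos hL⟩
  have hE : coupledGroundStateEnergy 0 lam N L ≠ ⊤ := by
    rw [coupledGroundStateEnergy_zeroPotential lam N hL]; exact ENNReal.zero_ne_top
  exact exists_forall_fsAngle_le_of_gap (fun Φ : TaggedPeriodicTrialState N L => Φ.memLp_two.toLp Φ.ψ)
    TaggedPeriodicTrialState.inner_toLp
    ((TaggedPeriodicTrialState.const N hL).memLp_two.toLp (TaggedPeriodicTrialState.const N hL).ψ)
    (TaggedPeriodicTrialState.const N hL).norm_toLp (by positivity : (0 : ℝ) < (2 * Real.pi / L) ^ 2)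
    hE (gapInequality_zeroPotential hL lam) hε

/-- The free gas is an admissible pair potential of the Bose–gas routes: `IsRepulsiveFiniteRange 0`
(measurable, range `0`). [folklore] -/
theorem isRepulsiveFiniteRange_zero : IsRepulsiveFiniteRange (0 : ℝ → ℝ≥0∞) :=
  ⟨measurable_const, 0, fun _ _ => rfl⟩

/-- **The crux stub `stub_nearMinimiserRigidity` holds for the free gas**: in its exact shape
(thermodynamic boxes `L = sideLength ρ (N+1)`, eventually in `N`, uniformly in `λ ∈ [0,1]`), for the
admissible potential `v = 0` (`isRepulsiveFiniteRange_zero`) — in fact for every `ρ₀`, `ρ`, `N`, `λ`.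
[folklore] -/
theorem nearMinimiserRigidity_zeroPotential :
    ∃ ρ₀ : ℝ, 0 < ρ₀ ∧ ∀ ρ : ℝ, 0 < ρ → ρ < ρ₀ → ∀ᶠ N : ℕ in atTop,
      ∀ lam ∈ Set.Icc (0 : ℝ) 1, ∀ ε : ℝ, 0 < ε →
        ∃ δ : ℝ≥0∞, 0 < δ ∧ ∀ Ψ Ψ' : TaggedPeriodicTrialState N (sideLength ρ (N + 1)),
          coupledEnergy 0 lam Ψ ≤ coupledGroundStateEnergy 0 lam N (sideLength ρ (N + 1)) + δ →
          coupledEnergy 0 lam Ψ' ≤ coupledGroundStateEnergy 0 lam N (sideLength ρ (N + 1)) + δ →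
            fsAngle Ψ Ψ' ≤ ε :=
  ⟨1, one_pos, fun ρ _ _ => Eventually.of_forall fun N lam _ _ hε =>
    exists_forall_fsAngle_le_zeroPotential N (sideLength ρ (N + 1)) lam hε⟩

end Literature.MathematicalPhysics.QuantumManyBody.BoseGas

end
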